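import Mathlib.Analysis.Matrix.Order
import Mathlib.Algebra.Ring.Action.ConjAct
import Literature.RepresentationTheory.FiniteGroups.WedderburnBlocks
import HarnessLib

/-!
# Unitary Wedderburn decomposition: `ℂ[G] ≃ ∏ᵢ ℂ^{dᵢ×dᵢ}` with every `g ∈ G` sent to unitary blocks

Topic `Literature/RepresentationTheory/FiniteGroups`. For a finite group `G` we PROVE that the
Wedderburn isomorphism of the tree (`exists_algEquiv_pi_matrix`, `WedderburnBlocks.lean`:
Maschke + Wedderburn–Artin from Mathlib) can be chosen **unitary**: there is an algebra
isomorphism `φ : ℂ[G] ≃ₐ[ℂ] ∏ᵢ ℂ^{dᵢ×dᵢ}` with `(φ g)ᵢᴴ (φ g)ᵢ = 1` for all `g ∈ G` and all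
blocks `i` (`exists_unitary_algEquiv_pi_matrix`). This is what makes the blocks honest unitary
irreducible representations `π`, with `π(g⁻¹) = π(g)ᴴ` (`algEquiv_single_inv_eq_conjTranspose`),
as used in non-abelian Fourier analysis (Parseval `∑_g |f(g)|² = |G|⁻¹ ∑_π d_π ‖f̂(π)‖²_F`);
intended for the proof of the named fact `QuasirandomBarrier` (Blasiak–Cohn–Grochow–Pratt–Umans
2023, Thm. 3.2; `Literature/Barriers/MatrixMultiplication/QuasirandomBarrier.lean`).

Proof (Weyl's unitarian trick, Serre 1977, §1.3, Remark after Thm. 1: the scalar product may be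
made invariant "by replacing `(x|y)` by `∑_{t ∈ G} (ρ_t x | ρ_t y)`", and then "the matrix of
`ρ_s` with respect to this basis is a unitary matrix"): for each block representation
`ρ : G →* ℂ^{n×n}`, `P = ∑_g ρ(g)ᴴ ρ(g)` is positive definite and `ρ(h)ᴴ P ρ(h) = P`; writing
`P = Yᴴ Y` with `Y` invertible (Mathlib: non-negative elements of the C⋆-algebra `ℂ^{n×n}` are
of the form `star Y * Y`), `Y ρ(g) Y⁻¹` is unitary (`exists_conj_unitary`); conjugating block `i`
by the unit `Yᵢ` is Mathlib's inner algebra automorphism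
`MulSemiringAction.toAlgEquiv ℂ _ (ConjAct.toConjAct Yᵢ)` of `ℂ^{dᵢ×dᵢ}`.

## References

* J.-P. Serre, *Linear Representations of Finite Groups*, GTM 42, Springer 1977, §1.3 (Remark:
  unitarisability of representations of finite groups), §6.2 Prop. 10 (held:
  `book:serre1977-linear-representations-finite-groups`). [Serre1977]
* J. Blasiak, H. Cohn, J. A. Grochow, K. Pratt, C. Umans, *Matrix multiplication via matrix
  groups*, ITCS 2023, arXiv:2204.03826, proof of Thm. 3.2. [BlasiakCohnGrochowPrattUmans2023]
-/

noncomputable section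

open scoped BigOperators MatrixOrder ComplexOrder Matrix

namespace Literature.RepresentationTheory.FiniteGroups

section Conj

variable {n : Type*} [Fintype n] [DecidableEq n]

/-- **Weyl's unitarian trick** (Serre 1977, §1.3, Remark): a representation `ρ : G →* ℂ^{n×n}` of
a finite group is conjugate to a unitary one — there is an invertible `Y` with
`(Y ρ(g) Y⁻¹)ᴴ (Y ρ(g) Y⁻¹) = 1` for all `g`. Proof: `P = ∑_g ρ(g)ᴴ ρ(g)` is positive definite and
`ρ`-invariant, `P = Yᴴ Y`. [cite: Serre1977, §1.3 Remark] -/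
theorem exists_conj_unitary {G : Type*} [Group G] [Finite G] (ρ : G →* Matrix n n ℂ) :
    ∃ u : (Matrix n n ℂ)ˣ, ∀ g : G,
      ((u : Matrix n n ℂ) * ρ g * ((u⁻¹ : (Matrix n n ℂ)ˣ) : Matrix n n ℂ))ᴴ *
        ((u : Matrix n n ℂ) * ρ g * ((u⁻¹ : (Matrix n n ℂ)ˣ) : Matrix n n ℂ)) = 1 := by
  classical
  haveI : Fintype G := Fintype.ofFinite G
  set P : Matrix n n ℂ := ∑ g, (ρ g)ᴴ * ρ g with hP
  have hPsd : P.PosSemidef :=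
    Matrix.posSemidef_sum _ fun g _ => Matrix.posSemidef_conjTranspose_mul_self _
  have hPd : P.PosDef := by
    have hsplit : P = 1 + ∑ g ∈ Finset.univ.erase (1 : G), (ρ g)ᴴ * ρ g := by
      rw [hP, ← Finset.add_sum_erase _ _ (Finset.mem_univ (1 : G)), map_one,
        Matrix.conjTranspose_one, Matrix.one_mul]
    rw [hsplit]
    exact Matrix.PosDef.one.add_posSemidef
      (Matrix.posSemidef_sum _ fun g _ => Matrix.posSemidef_conjTranspose_mul_self _)
  have hinv : ∀ h : G, (ρ h)ᴴ * P * ρ h = P := by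
    intro h
    rw [hP, Finset.mul_sum, Finset.sum_mul]
    have : ∀ g : G, (ρ h)ᴴ * ((ρ g)ᴴ * ρ g) * ρ h = (ρ (g * h))ᴴ * ρ (g * h) := fun g => by
      rw [map_mul, Matrix.conjTranspose_mul]
      simp only [Matrix.mul_assoc]
    simp_rw [this]
    exact Fintype.sum_equiv (Equiv.mulRight h) _ _ fun g => rfl
  obtain ⟨Y, hY⟩ := CStarAlgebra.nonneg_iff_eq_star_mul_self.mp hPsd.nonneg
  rw [Matrix.star_eq_conjTranspose] at hY
  have hYu : IsUnit Y := by
    have hu : IsUnit P := hPd.isUnit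
    rw [hY, Matrix.isUnit_iff_isUnit_det, Matrix.det_mul] at hu
    exact (Matrix.isUnit_iff_isUnit_det Y).2 (isUnit_of_mul_isUnit_right hu)
  obtain ⟨u, rfl⟩ := hYu
  refine ⟨u, fun g => ?_⟩
  calc ((u : Matrix n n ℂ) * ρ g * ↑u⁻¹)ᴴ * (↑u * ρ g * ↑u⁻¹)
      = (↑u⁻¹ : Matrix n n ℂ)ᴴ * ((ρ g)ᴴ * ((↑u : Matrix n n ℂ)ᴴ * ↑u) * ρ g) * ↑u⁻¹ := by
        simp only [Matrix.conjTranspose_mul, Matrix.mul_assoc]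
    _ = (↑u⁻¹ : Matrix n n ℂ)ᴴ * ((↑u : Matrix n n ℂ)ᴴ * ↑u) * ↑u⁻¹ := by rw [← hY, hinv]
    _ = ((u : Matrix n n ℂ) * ↑u⁻¹)ᴴ * ((u : Matrix n n ℂ) * ↑u⁻¹) := by
        simp only [Matrix.conjTranspose_mul, Matrix.mul_assoc]
    _ = 1 := by rw [u.mul_inv, Matrix.conjTranspose_one, Matrix.one_mul]

/-- Mathlib's inner automorphism of `ℂ^{n×n}` by a unit `u` acts as `M ↦ u M u⁻¹`. [folklore] -/
theorem toAlgEquiv_toConjAct_apply (u : (Matrix n n ℂ)ˣ) (M : Matrix n n ℂ) :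
    MulSemiringAction.toAlgEquiv ℂ (Matrix n n ℂ) (ConjAct.toConjAct u) M =
      (u : Matrix n n ℂ) * M * ((u⁻¹ : (Matrix n n ℂ)ˣ) : Matrix n n ℂ) := by
  rw [MulSemiringAction.toAlgEquiv_apply, ConjAct.units_smul_def, ConjAct.ofConjAct_toConjAct]

end Conj

/-- **Unitary Wedderburn decomposition**: for a finite group `G` there are block sizes
`d₁, …, d_r ≥ 1` and an algebra isomorphism `φ : ℂ[G] ≃ₐ[ℂ] ∏ᵢ ℂ^{dᵢ×dᵢ}` under which every
group element has **unitary** blocks, `(φ g)ᵢᴴ (φ g)ᵢ = 1` (Serre 1977, §6.2 Prop. 10 with §1.3: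
the irreducible representations `ρᵢ` "in matrix form" may be taken unitary). From the tree's
`exists_algEquiv_pi_matrix` by conjugating each block by a unit (`exists_conj_unitary`,
Mathlib's `MulSemiringAction.toAlgEquiv` of the conjugation action `ConjAct`).
[cite: Serre1977, §6.2 Prop. 10] -/
theorem exists_unitary_algEquiv_pi_matrix (G : Type) [Group G] [Finite G] :
    ∃ (r : ℕ) (d : Fin r → ℕ), (∀ i, NeZero (d i)) ∧
      ∃ φ : MonoidAlgebra ℂ G ≃ₐ[ℂ] BlockAlgebraC d, ∀ (g : G) (i : Fin r),
        (φ (MonoidAlgebra.single g 1) i)ᴴ * φ (MonoidAlgebra.single g 1) i = 1 := by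
  classical
  obtain ⟨r, d, hd, ⟨φ₀⟩⟩ := exists_algEquiv_pi_matrix G
  let ρ : ∀ i : Fin r, G →* Matrix (Fin (d i)) (Fin (d i)) ℂ := fun i =>
    (((Pi.evalAlgHom ℂ (fun i : Fin r => Matrix (Fin (d i)) (Fin (d i)) ℂ) i).comp
      φ₀.toAlgHom).toMonoidHom).comp (MonoidAlgebra.of ℂ G)
  have hρ : ∀ i g, ρ i g = φ₀ (MonoidAlgebra.single g 1) i := fun i g => rfl
  choose u hu using fun i => exists_conj_unitary (ρ i)
  let ψ : BlockAlgebraC d ≃ₐ[ℂ] BlockAlgebraC d :=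
    AlgEquiv.piCongrRight fun i =>
      MulSemiringAction.toAlgEquiv ℂ (Matrix (Fin (d i)) (Fin (d i)) ℂ) (ConjAct.toConjAct (u i))
  refine ⟨r, d, hd, φ₀.trans ψ, fun g i => ?_⟩
  have happ : (φ₀.trans ψ) (MonoidAlgebra.single g 1) i =
      (u i : Matrix _ _ ℂ) * ρ i g * (((u i)⁻¹ : (Matrix _ _ ℂ)ˣ) : Matrix _ _ ℂ) := by
    rw [hρ, AlgEquiv.trans_apply, AlgEquiv.piCongrRight_apply, toAlgEquiv_toConjAct_apply]
  rw [happ]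
  exact hu i g

/-- Under a unitary decomposition, inverses go to conjugate transposes blockwise:
`(φ g⁻¹)ᵢ = (φ g)ᵢᴴ`. [folklore] -/
theorem algEquiv_single_inv_eq_conjTranspose {G : Type} [Group G] {r : ℕ} {d : Fin r → ℕ}
    (φ : MonoidAlgebra ℂ G ≃ₐ[ℂ] BlockAlgebraC d)
    (hφ : ∀ (g : G) (i : Fin r),
      (φ (MonoidAlgebra.single g 1) i)ᴴ * φ (MonoidAlgebra.single g 1) i = 1)
    (g : G) (i : Fin r) :
    φ (MonoidAlgebra.single g⁻¹ 1) i = (φ (MonoidAlgebra.single g 1) i)ᴴ := by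
  have hinv : φ (MonoidAlgebra.single g⁻¹ 1) i * φ (MonoidAlgebra.single g 1) i = 1 := by
    rw [← Pi.mul_apply, ← map_mul, MonoidAlgebra.single_mul_single, inv_mul_cancel, mul_one,
      ← MonoidAlgebra.one_def, map_one, Pi.one_apply]
  -- both are left inverses of the invertible matrix `(φ g)ᵢ`
  have hr : φ (MonoidAlgebra.single g 1) i * φ (MonoidAlgebra.single g⁻¹ 1) i = 1 :=
    mul_eq_one_comm.1 hinv
  calc φ (MonoidAlgebra.single g⁻¹ 1) i
      = (φ (MonoidAlgebra.single g 1) i)ᴴ * (φ (MonoidAlgebra.single g 1) i *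
          φ (MonoidAlgebra.single g⁻¹ 1) i) := by
        rw [← Matrix.mul_assoc, hφ, Matrix.one_mul]
    _ = (φ (MonoidAlgebra.single g 1) i)ᴴ := by rw [hr, Matrix.mul_one]

end Literature.RepresentationTheory.FiniteGroups

end
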